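import Mathlib.Algebra.MvPolynomial.PDeriv
import Mathlib.LinearAlgebra.Matrix.Determinant.Basic
import Literature.ModelTheory.PseudofiniteFields.EtaleOpenTopologyBasis
import HarnessLib

/-!
# Standard étale images: pull-back along coordinate maps (cylinders)

Topic `Literature/ModelTheory/PseudofiniteFields`.  Proof-only companion of `EtaleOpenTopology.lean`
and `EtaleOpenTopologyBasis.lean` (images `EtaleDatum.image` of standard étale data
`(G_1, …, G_r ; H)` over `K^m`).  Context: W. Johnson, C.-M. Tran, E. Walsberg, J. Ye, *The
étale-open topology and the stable fields conjecture*, J. Eur. Math. Soc. 26 (2024)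
[JohnsonTranWalsbergYe2024], §1: the étale-open topologies form a *system of topologies* — for a
morphism `f : V → W` the map `V(K) → W(K)` is continuous — because étale morphisms are stable
under base change.  The elementary instance needed downstream (chart induction for definable sets
in pseudo-finite fields) is the coordinate map `K^m → K^{m'}`, `x ↦ x ∘ ι` for ANY map
`ι : Fin m' → Fin m` (coordinate projections for `ι` injective, diagonals otherwise):

* `EtaleDatum.exists_image_eq_preimage_comp` — for every datum `E` over `K^{m'}` there is a datum
  `E'` over `K^m` with the same number of auxiliary variables and image `{x | x ∘ ι ∈ E.image}`:
  rename the set variables `X_i ↦ X_{ι i}` and keep the auxiliary variables (the base change of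
  `Spec K[X', T]_{HJ}/(G) → 𝔸^{m'}` along `𝔸^m → 𝔸^{m'}`).  The renaming commutes with every
  `∂/∂T_j` (`EtaleDatum.pderiv_inr_rename_sumMap`, no injectivity needed since only set
  variables are renamed), hence with the Jacobian determinant
  (`EtaleDatum.jacobianDet_mk_rename_sumMap`), and evaluation at `(x, t)` of a renamed
  polynomial is evaluation at `(x ∘ ι, t)` (`EtaleDatum.eval_sumElim_rename_sumMap`).

Everything is proved by direct computation with the definitions over a commutative ring `K`; no
named fact is used, no new definition is made.

## References

* W. Johnson, C.-M. Tran, E. Walsberg, J. Ye, *The étale-open topology and the stable fields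
  conjecture*, J. Eur. Math. Soc. 26 (2024) 4033–4070, §1 (étale images, system of topologies).
  [JohnsonTranWalsbergYe2024]

## Not here

Pull-back along general polynomial maps `K^m → K^{m'}` (same proof with `aeval` in place of
`rename`), finite unions, the topology as a `TopologicalSpace`.
-/

namespace Literature.ModelTheory.PseudofiniteFields

open MvPolynomial

namespace EtaleDatum

variable {K : Type*} [CommRing K] {m m' r : ℕ}

/-- Evaluating a polynomial in the renamed set variables `X_{ι i}` and the auxiliary variables
`T_j` at `(x, t)` is evaluating the original polynomial at `(x ∘ ι, t)`. [folklore] -/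
theorem eval_sumElim_rename_sumMap (ι : Fin m' → Fin m) (x : Fin m → K) (t : Fin r → K)
    (p : MvPolynomial (Fin m' ⊕ Fin r) K) :
    eval (Sum.elim x t) (rename (Sum.map ι id) p) = eval (Sum.elim (x ∘ ι) t) p := by
  rw [eval_rename, Sum.elim_comp_map]
  rfl

/-- Renaming the set variables only (`X_i ↦ X_{ι i}`, `T_j ↦ T_j`) commutes with every partial
derivative `∂/∂T_j` in an auxiliary variable — for an arbitrary map `ι`, injective or not.
[folklore] -/
theorem pderiv_inr_rename_sumMap (ι : Fin m' → Fin m) (j : Fin r)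
    (p : MvPolynomial (Fin m' ⊕ Fin r) K) :
    pderiv (Sum.inr j) (rename (Sum.map ι id) p) =
      rename (Sum.map ι id) (pderiv (Sum.inr j) p) := by
  induction p using MvPolynomial.induction_on with
  | C a => simp
  | add p q hp hq => simp [hp, hq]
  | mul_X p s hp =>
    rcases s with i | j'
    · simp [hp]
    · by_cases h : j' = j
      · subst h
        simp [hp]
      · simp [hp, h]

/-- **Jacobian of the renamed datum**: renaming the set variables of all equations of a datum
renames its Jacobian determinant (the determinant commutes with the ring map `rename`, and
`rename` commutes with the `∂/∂T_j`). [folklore] -/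
theorem jacobianDet_mk_rename_sumMap (ι : Fin m' → Fin m) (E : EtaleDatum K m' r)
    (H : MvPolynomial (Fin m ⊕ Fin r) K) :
    jacobianDet (⟨fun i => rename (Sum.map ι id) (E.G i), H⟩ : EtaleDatum K m r) =
      rename (Sum.map ι id) E.jacobianDet := by
  rw [jacobianDet, jacobianDet, AlgHom.map_det, AlgHom.mapMatrix_apply]
  congr 1
  ext i j
  simp [pderiv_inr_rename_sumMap]

/-- **Étale images pull back along coordinate maps** (cylinders and diagonals): for every map
`ι : Fin m' → Fin m` and every standard étale datum `E` over `K^{m'}` there is a standard étale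
datum `E'` over `K^m`, with the same number of auxiliary variables, whose image is the preimage
`{x ∈ K^m | x ∘ ι ∈ E.image}` of the image of `E` under `x ↦ x ∘ ι` — namely `E` with the set
variables renamed, `X_i ↦ X_{ι i}` (witness: the same `t`).  For `ι` a coordinate embedding this
says that cylinders over basic étale-open sets are basic étale-open. [folklore] -/
theorem exists_image_eq_preimage_comp (ι : Fin m' → Fin m) (E : EtaleDatum K m' r) :
    ∃ E' : EtaleDatum K m r, E'.image = {x | (x ∘ ι) ∈ E.image} := by
  refine ⟨⟨fun i => rename (Sum.map ι id) (E.G i), rename (Sum.map ι id) E.H⟩,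
    Set.ext fun x => ?_⟩
  rw [Set.mem_setOf_eq, mem_image_iff, mem_image_iff, jacobianDet_mk_rename_sumMap]
  simp only [eval_sumElim_rename_sumMap]

end EtaleDatum

end Literature.ModelTheory.PseudofiniteFields
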